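import Summits.NavierStokesRegularity.NavierStokesRegularity.Theorems.CriticalCoherenceDoorDefs
import Summits.NavierStokesRegularity.NavierStokesRegularity.Theorems.CriticalCoherenceDoorGronwallTools
import HarnessLib

/-!
# CriticalCoherenceDoorGronwall — door S33 «CriticalCoherenceDoor», plate G33 «PowerGronwallSlab», PROVED

S-door lane helper (ns-s29-p2 g4, first free hand on LEAD ns-s30-p1 g2's plate map 2026-08-28T13:14:22Z;
texts of record nsreg-p1 g27 `r31/Sketch33.lean` sha16 ae52fe0f17f630b4, plate aid `r31/PLATE-AID-33.md`
ac753e4a397d9491), `--supports stmt-NavierStokesRegularity-0056 --as helper`.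

`powerGronwallSlab_holds : PowerGronwallSlab` — BY NAME against plate P0
(`Theorems/CriticalCoherenceDoorDefs.lean`, p636457).  The statement is the tree's slab Grönwall step
`Literature.Analysis.FluidPDE.integral_sq_norm_curl_le_of_direction_slab`
(`ConstantinFeffermanEnstrophySlab.lean` :351) with ONE extra, singular-but-subcritical coefficient
`a/(T − t)` (`0 ≤ a`, slab `[0, T'']`, `T'' < T`) in the stretching inequality, and the extra factor
`(T/(T − t))^a = exp(∫₀ᵗ a/(T − s) ds)` in the conclusion:
`∫|ω(t)|² ≤ (∫|ω(0)|² + C₄ I)·(T/(T − t))^a·exp((C₁ + C₃Ē)T'' + C₂‖curl‖²I)` on `[0, T'']`.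

Proof = the tree's proof verbatim (vorticity energy identity `integral_inner_curl_eq_of_vorticity_eq`,
enstrophy balance `IsSmoothSpaceTimeOn.l2_balance`, Grönwall in lower-integral form `lintegral_gronwall_le`,
whose exponent is `∫_{(0,t)}` of the kernel), with the kernel `a/(T − s) + C₁ + C₂∫|ω(s)|² + C₃Ē`
(bounded on `[0, T'']` because `T − s ≥ T − T'' > 0`) and the logarithmic integral
`∫_{(0,t)} a/(T − s) ds = a log(T/(T − t))` (`lintegral_Ioo_div_sub_eq` of the Tools file), so that
`exp(a log(T/(T − t)) + E) = (T/(T − t))^a exp E` (`Real.rpow_def_of_pos`).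

WHAT THIS IS NOT: one plate (the Grönwall bookkeeping) of a regularity CRITERION about hypothetical
blow-up; item 0056 `NoTypeII` and NS regularity are NOT proved; no Literature fact is taken as a
hypothesis; nothing here is a route or a summit statement.
-/

noncomputable section

open MeasureTheory Set Function Filter Metric Real InnerProductSpace
open _root_.Topology
open scoped ENNReal NNReal RealInnerProductSpace ContDiff Laplacian
open Literature.Analysis.FluidPDE

set_option linter.dupNamespace false

namespace Summit.NavierStokesRegularity.NavierStokesRegularity.Theorems.CriticalCoherenceDoor

-- nested operator types (second and third derivatives)
set_option maxSynthPendingDepth 3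

set_option maxHeartbeats 1600000 in
/-- plate G33 «PowerGronwallSlab» PROVED (the Grönwall step of door S33 with one
singular-but-subcritical coefficient).  On a closed slab `[0, T''] × ℝ³`, `0 < T'' < T`, for a classical
unforced Navier–Stokes solution with bounded Sobolev seminorms, energy `≤ Ē` and dissipation `≤ I`, a
stretching inequality with coefficient `a/(T − t) + C₁ + C₂∫|ω|² + C₃∫|u|²` (`a ≥ 0`) yields
`∫|ω(t)|² ≤ (∫|ω(0)|² + C₄ I)·(T/(T − t))^a·exp((C₁ + C₃Ē)T'' + C₂‖curl‖²I)` on `[0, T'']`.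
Proof: the tree's `integral_sq_norm_curl_le_of_direction_slab` verbatim with the kernel
`a/(T − s) + C₁ + C₂∫|ω(s)|² + C₃Ē` and `∫₀ᵗ a/(T − s) ds = a log(T/(T − t))`. -/
theorem powerGronwallSlab_holds : PowerGronwallSlab := by
  intro ν T T'' a hν hT'' hT''T ha u p hS hB Ē I hĒ hI hen hdiss C₁ C₂ C₃ C₄ hC₁ hC₂ hC₃ hC₄ hstr
  have hU : UniqueDiffOn ℝ (Icc 0 T'') := uniqueDiffOn_Icc hT''
  have h0S : (0 : ℝ) ∈ Icc 0 T'' := ⟨le_rfl, hT''.le⟩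
  have hT : 0 < T := hT''.trans hT''T
  have hTT : 0 < T - T'' := sub_pos.2 hT''T
  have hTt : ∀ t ∈ Icc 0 T'', 0 < T - t := fun t ht => by linarith [ht.2]
  set κ : ℝ := ‖curlCLM‖ with hκ
  -- smoothness of the slices
  have hsm : ∀ t ∈ Icc 0 T'', ContDiff ℝ ∞ (u t) := fun t ht => hS.contDiff_velocity ht
  have hsm3 : ∀ t ∈ Icc 0 T'', ContDiff ℝ 3 (u t) := fun t ht => (hsm t ht).of_le (by norm_cast)
  have hsm2 : ∀ t ∈ Icc 0 T'', ContDiff ℝ 2 (u t) := fun t ht => (hsm t ht).of_le (by norm_cast)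
  -- sup bounds
  obtain ⟨B₀, hB₀⟩ := linfty_bound_of_hasBoundedSobolevNormsOn_holds hsm2 hB
  obtain ⟨B₁, hB₁0, hB₁⟩ := exists_forall_norm_fderiv_le_of_hasBoundedSobolevNormsOn hsm3 hB
  have hB₀0 : 0 ≤ B₀ := (norm_nonneg _).trans (hB₀ 0 h0S 0)
  -- the Sobolev bounds
  have hfin : ∀ n, ∀ t ∈ Icc 0 T'', ∫⁻ x, ‖iteratedFDeriv ℝ n (u t) x‖ₑ ^ 2 < ⊤ := fun n t ht => by
    obtain ⟨C, hC⟩ := hB n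
    exact (hC t ht).trans_lt ENNReal.coe_lt_top
  choose Cn hCn using hB
  -- the vorticity field and its time derivative
  set vort : ℝ → (EuclideanSpace ℝ (Fin 3)) → (EuclideanSpace ℝ (Fin 3)) := vorticity u with hωdef
  have hωt : ∀ t, vort t = curl (u t) := fun t => rfl
  have hωsm : IsSmoothSpaceTimeOn (Icc 0 T'') vort :=
    (hS.smooth_velocity.fderiv_slice hU).clm_comp curlCLM
  set W : ℝ → (EuclideanSpace ℝ (Fin 3)) → (EuclideanSpace ℝ (Fin 3)) :=
    timeDerivWithin (Icc 0 T'') vort with hWdef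
  have hWsm : IsSmoothSpaceTimeOn (Icc 0 T'') W := hωsm.timeDerivWithin hU
  have hvort : ∀ t ∈ Icc 0 T'', ∀ x,
      W t x + convect (u t) (vort t) x = convect (vort t) (u t) x + ν • (Δ (vort t)) x :=
    fun t ht x =>
    (hS.isVorticitySolutionOn_of_uniqueDiffOn hU (fun s _ y => curl_zero y)).vorticity_eq t ht x
  -- `L²` bound for the vorticity
  set V₀ : ℝ≥0∞ := ENNReal.ofReal (κ ^ 2) * (Cn 1 : ℝ≥0∞) with hV₀
  have hV₀top : V₀ < ⊤ := ENNReal.mul_lt_top ENNReal.ofReal_lt_top ENNReal.coe_lt_top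
  have hωL2 : ∀ t ∈ Icc 0 T'', ∫⁻ x, ‖vort t x‖ₑ ^ 2 ≤ V₀ := fun t ht =>
    (lintegral_curl_sq_le (u t)).trans (mul_le_mul' le_rfl (hCn 1 t ht))
  -- `L²` bound for the time derivative of the vorticity
  set V₁ : ℝ≥0∞ := 3 * (ENNReal.ofReal ((ν * (3 * κ)) ^ 2) * (Cn 3 : ℝ≥0∞) +
    ENNReal.ofReal ((B₀ * κ) ^ 2) * (Cn 2 : ℝ≥0∞) + ENNReal.ofReal ((B₁ * κ) ^ 2) * (Cn 1 : ℝ≥0∞))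
    with hV₁
  have hV₁top : V₁ < ⊤ := by
    refine ENNReal.mul_lt_top (by norm_num) ?_
    refine ENNReal.add_lt_top.2 ⟨ENNReal.add_lt_top.2 ⟨?_, ?_⟩, ?_⟩ <;>
      exact ENNReal.mul_lt_top ENNReal.ofReal_lt_top ENNReal.coe_lt_top
  have hWL2 : ∀ t ∈ Icc 0 T'', ∫⁻ x, ‖W t x‖ₑ ^ 2 ≤ V₁ := by
    intro t ht
    refine (lintegral_enorm_sq_le_of_vorticity_eq hν hB₀0 hB₁0 (hsm3 t ht) (hB₀ t ht) (hB₁ t ht)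
      (fun x => by rw [← hωt t]; exact hvort t ht x)).trans ?_
    rw [hV₁]
    exact mul_le_mul' le_rfl (add_le_add (add_le_add (mul_le_mul' le_rfl (hCn 3 t ht))
      (mul_le_mul' le_rfl (hCn 2 t ht))) (mul_le_mul' le_rfl (hCn 1 t ht)))
  -- the balance of the enstrophy
  obtain ⟨-, hYcont, hbal⟩ := hωsm.l2_balance hT'' (C₀ := V₀.toNNReal) (C₁ := V₁.toNNReal)
    (fun t ht => by rw [ENNReal.coe_toNNReal hV₀top.ne]; exact hωL2 t ht)
    (fun t ht => by rw [ENNReal.coe_toNNReal hV₁top.ne]; exact hWL2 t ht)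
  -- the quantities
  set Y : ℝ → ℝ := fun t => ∫ x, ‖vort t x‖ ^ 2 with hYdef
  set F : ℝ → ℝ := fun t => ∫ x, frobeniusNormSq (fderiv ℝ (u t) x) with hFdef
  set Φ : ℝ → ℝ := fun t => ∫ x, 2 * ⟪vort t x, W t x⟫ with hΦdef
  have hY0 : ∀ t, 0 ≤ Y t := fun t => integral_nonneg fun x => sq_nonneg _
  have hF0 : ∀ t, 0 ≤ F t := fun t => integral_nonneg fun x => frobeniusNormSq_nonneg _
  -- real energy and its bound
  have hEreal : ∀ t ∈ Icc 0 T'', ∫ x, ‖u t x‖ ^ 2 ≤ Ē := by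
    intro t ht
    have hfin0 : ∫⁻ x, ‖u t x‖ₑ ^ 2 < ⊤ := (hen t ht).trans_lt ENNReal.ofReal_lt_top
    have hi : Integrable fun x => ‖u t x‖ ^ 2 :=
      integrable_sq_norm_of_lintegral_lt_top (hsm t ht).continuous hfin0
    have h := hen t ht
    rw [show (∫⁻ x, ‖u t x‖ₑ ^ 2) = ∫⁻ x, ENNReal.ofReal (‖u t x‖ ^ 2) from
      lintegral_congr fun x => by rw [← ofReal_norm, ENNReal.ofReal_pow (norm_nonneg _)],
      ← ofReal_integral_eq_lintegral_ofReal hi (Eventually.of_forall fun x => sq_nonneg _)] at h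
    exact (ENNReal.ofReal_le_ofReal_iff hĒ).1 h
  -- integrability of `|∇u(t)|²_F`, and `F` versus the dissipation
  have hFint : ∀ t ∈ Icc 0 T'', Integrable fun x => frobeniusNormSq (fderiv ℝ (u t) x) := by
    intro t ht
    have hlt : ∫⁻ x, ENNReal.ofReal (frobeniusNormSq (fderiv ℝ (u t) x)) < ⊤ := by
      calc ∫⁻ x, ENNReal.ofReal (frobeniusNormSq (fderiv ℝ (u t) x))
          ≤ ∫⁻ x, 3 * ‖fderiv ℝ (u t) x‖ₑ ^ 2 :=
            lintegral_mono fun x => ofReal_frobeniusNormSq_le_three_mul_enorm_sq _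
        _ = 3 * ∫⁻ x, ‖iteratedFDeriv ℝ 1 (u t) x‖ₑ ^ 2 := by
            rw [lintegral_const_mul' _ _ (by norm_num)]
            congr 1
            exact lintegral_congr fun x => by
              rw [← ofReal_norm, ← norm_iteratedFDeriv_one, ofReal_norm]
        _ < ⊤ := ENNReal.mul_lt_top (by norm_num) (hfin 1 t ht)
    exact integrable_of_continuous_of_nonneg
      (continuous_frobeniusNormSq_fderiv (hsm2 t ht) (by simp))
      (fun x => frobeniusNormSq_nonneg _) hlt
  have hFof : ∀ t ∈ Icc 0 T'', ENNReal.ofReal (F t) =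
      ∫⁻ x, ENNReal.ofReal (frobeniusNormSq (fderiv ℝ (u t) x)) := fun t ht =>
    ofReal_integral_eq_lintegral_ofReal (hFint t ht)
      (Eventually.of_forall fun x => frobeniusNormSq_nonneg _)
  have hIF : ∫⁻ t in Ioo 0 T'', ENNReal.ofReal (F t) ≤ ENNReal.ofReal I := by
    refine le_trans (le_of_eq ?_) hdiss
    exact setLIntegral_congr_fun measurableSet_Ioo fun t ht => hFof t ⟨ht.1.le, ht.2.le⟩
  -- `Y ≤ κ² F` and `Y ≤ V₀`
  have hYle : ∀ t ∈ Icc 0 T'', Y t ≤ κ ^ 2 * F t := by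
    intro t ht
    have hi : Integrable fun x => ‖vort t x‖ ^ 2 := by
      refine integrable_sq_norm_of_lintegral_lt_top (hωsm.contDiff_slice ht).continuous ?_
      exact (hωL2 t ht).trans_lt hV₀top
    rw [hYdef, hFdef]
    show (∫ x, ‖vort t x‖ ^ 2) ≤ κ ^ 2 * ∫ x, frobeniusNormSq (fderiv ℝ (u t) x)
    rw [← integral_const_mul]
    refine integral_mono hi ((hFint t ht).const_mul _) fun x => ?_
    show ‖vort t x‖ ^ 2 ≤ κ ^ 2 * frobeniusNormSq (fderiv ℝ (u t) x)
    rw [hωt]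
    calc ‖curl (u t) x‖ ^ 2 ≤ (κ * ‖fderiv ℝ (u t) x‖) ^ 2 :=
          pow_le_pow_left₀ (norm_nonneg _) (norm_curl_le _ _) 2
      _ = κ ^ 2 * ‖fderiv ℝ (u t) x‖ ^ 2 := by ring
      _ ≤ κ ^ 2 * frobeniusNormSq (fderiv ℝ (u t) x) :=
          mul_le_mul_of_nonneg_left (sq_opNorm_le_frobeniusNormSq _) (sq_nonneg _)
  have hYV : ∀ t ∈ Icc 0 T'', ENNReal.ofReal (Y t) ≤ V₀ := by
    intro t ht
    have hi : Integrable fun x => ‖vort t x‖ ^ 2 := by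
      refine integrable_sq_norm_of_lintegral_lt_top (hωsm.contDiff_slice ht).continuous ?_
      exact (hωL2 t ht).trans_lt hV₀top
    rw [hYdef]
    show ENNReal.ofReal (∫ x, ‖vort t x‖ ^ 2) ≤ V₀
    rw [ofReal_integral_eq_lintegral_ofReal hi (Eventually.of_forall fun x => sq_nonneg _)]
    refine le_trans (le_of_eq (lintegral_congr fun x => ?_)) (hωL2 t ht)
    rw [← ofReal_norm, ENNReal.ofReal_pow (norm_nonneg _)]
  -- the slice inequality `Φ t ≤ ā t Y t + C₄ F t`, kernel `ā t = a/(T − t) + C₁ + C₂ Y t + C₃ Ē`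
  set ā : ℝ → ℝ := fun t => a / (T - t) + C₁ + C₂ * Y t + C₃ * Ē with hādef
  have hā0 : ∀ t ∈ Icc 0 T'', 0 ≤ ā t := fun t ht => by
    have h1 : 0 ≤ a / (T - t) := div_nonneg ha (hTt t ht).le
    have h2 : 0 ≤ C₂ * Y t := mul_nonneg hC₂ (hY0 t)
    show 0 ≤ a / (T - t) + C₁ + C₂ * Y t + C₃ * Ē
    positivity
  have hslice : ∀ t ∈ Icc 0 T'', Φ t ≤ ā t * Y t + C₄ * F t := by
    intro t ht
    have hv := hsm3 t ht
    have hid := integral_inner_curl_eq_of_vorticity_eq hv (hS.divFree t ht) (hvort t ht)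
      (hB₀ t ht) (hB₁ t ht) (hfin 1 t ht) (hfin 2 t ht) (hfin 3 t ht)
    have hst := hstr t ht
    have hE := hEreal t ht
    have hDnn : 0 ≤ ∫ x, frobeniusNormSq (fderiv ℝ (curl (u t)) x) :=
      integral_nonneg fun x => frobeniusNormSq_nonneg _
    have hΦt : Φ t = 2 * ∫ x, ⟪vort t x, W t x⟫ := by
      rw [hΦdef]
      exact integral_const_mul _ _
    rw [hΦt, hωt, hid]
    have hYt : Y t = ∫ x, ‖curl (u t) x‖ ^ 2 := rfl
    rw [hādef, hFdef]
    show 2 * (-ν * (∫ x, frobeniusNormSq (fderiv ℝ (curl (u t)) x)) +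
        ∫ x, ⟪curl (u t) x, fderiv ℝ (u t) x (curl (u t) x)⟫) ≤
      (a / (T - t) + C₁ + C₂ * Y t + C₃ * Ē) * Y t + C₄ * ∫ x, frobeniusNormSq (fderiv ℝ (u t) x)
    rw [hYt]
    have hY0' : 0 ≤ ∫ x, ‖curl (u t) x‖ ^ 2 := integral_nonneg fun x => sq_nonneg _
    have hmono : (a / (T - t) + C₁ + C₂ * (∫ x, ‖curl (u t) x‖ ^ 2) + C₃ * (∫ x, ‖u t x‖ ^ 2)) *
        (∫ x, ‖curl (u t) x‖ ^ 2) ≤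
        (a / (T - t) + C₁ + C₂ * (∫ x, ‖curl (u t) x‖ ^ 2) + C₃ * Ē) *
          (∫ x, ‖curl (u t) x‖ ^ 2) := by
      gcongr
    nlinarith [hst, hmono, hν, hDnn, mul_nonneg hν.le hDnn]
  -- Grönwall, lower-integral form
  set φ : ℝ → ℝ≥0∞ := fun t => ENNReal.ofReal (Y t) with hφdef
  set kern : ℝ → ℝ≥0∞ := fun t => ENNReal.ofReal (ā t) with hkdef
  set Bg : ℝ≥0∞ := ENNReal.ofReal (Y 0 + C₄ * I) with hBg
  have hineq : ∀ b ∈ Icc 0 T'', φ b ≤ Bg + ∫⁻ s in Ioo 0 b, kern s * φ s := by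
    intro b hb
    rcases eq_or_lt_of_le hb.1 with h0 | hb0
    · rw [← h0]
      simp only [Ioo_self, Measure.restrict_empty, lintegral_zero_measure, add_zero]
      rw [hφdef, hBg]
      exact ENNReal.ofReal_le_ofReal (le_add_of_nonneg_right (by positivity))
    have hbalb := hbal b ⟨hb0, hb.2⟩
    -- `Y b = Y 0 + ∫₀ᵇ Φ`
    have hYb : Y b = Y 0 + ∫ t in Ioo 0 b, Φ t := by
      have h : (∫ x, ‖vort b x‖ ^ 2) = (∫ x, ‖vort 0 x‖ ^ 2) + ∫ t in (0 : ℝ)..b, Φ t := hbalb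
      rw [intervalIntegral.integral_of_le hb0.le, integral_Ioc_eq_integral_Ioo] at h
      exact h
    -- pointwise bound on `(0, b)`
    have hpt : ∀ t ∈ Ioo 0 b, ENNReal.ofReal (Φ t) ≤
        ENNReal.ofReal (ā t * Y t) + ENNReal.ofReal (C₄ * F t) := by
      intro t ht
      have htS : t ∈ Icc 0 T'' := ⟨ht.1.le, ht.2.le.trans hb.2⟩
      rw [← ENNReal.ofReal_add (mul_nonneg (hā0 t htS) (hY0 t)) (mul_nonneg hC₄ (hF0 t))]
      exact ENNReal.ofReal_le_ofReal (hslice t htS)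
    -- the two pieces of the right-hand side
    have hI1 : ∫⁻ t in Ioo 0 b, ENNReal.ofReal (ā t * Y t) = ∫⁻ t in Ioo 0 b, kern t * φ t :=
      setLIntegral_congr_fun measurableSet_Ioo fun t ht => by
        have htS : t ∈ Icc 0 T'' := ⟨ht.1.le, ht.2.le.trans hb.2⟩
        rw [hkdef, hφdef, ← ENNReal.ofReal_mul (hā0 t htS)]
    have hI2 : ∫⁻ t in Ioo 0 b, ENNReal.ofReal (C₄ * F t) ≤ ENNReal.ofReal (C₄ * I) := by
      calc ∫⁻ t in Ioo 0 b, ENNReal.ofReal (C₄ * F t)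
          ≤ ∫⁻ t in Ioo 0 T'', ENNReal.ofReal (C₄ * F t) :=
            lintegral_mono_set (Ioo_subset_Ioo le_rfl hb.2)
        _ = ENNReal.ofReal C₄ * ∫⁻ t in Ioo 0 T'', ENNReal.ofReal (F t) := by
            rw [← lintegral_const_mul' _ _ ENNReal.ofReal_ne_top]
            exact lintegral_congr fun t => ENNReal.ofReal_mul hC₄
        _ ≤ ENNReal.ofReal C₄ * ENNReal.ofReal I := mul_le_mul' le_rfl hIF
        _ = ENNReal.ofReal (C₄ * I) := (ENNReal.ofReal_mul hC₄).symm
    have hmeas1 : AEMeasurable (fun t => ENNReal.ofReal (ā t * Y t)) (volume.restrict (Ioo 0 b)) := by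
      have hāY_cont : ContinuousOn (fun t => ā t * Y t) (Icc 0 T'') := by
        have hYc : ContinuousOn Y (Icc 0 T'') := hYcont
        have hdiv : ContinuousOn (fun t : ℝ => a / (T - t)) (Icc 0 T'') :=
          continuousOn_const.div (continuousOn_const.sub continuousOn_id) fun t ht => (hTt t ht).ne'
        exact (((hdiv.add continuousOn_const).add (continuousOn_const.mul hYc)).add
          continuousOn_const).mul hYc
      exact (ENNReal.continuous_ofReal.comp_continuousOn
        (hāY_cont.mono (Ioo_subset_Icc_self.trans (Icc_subset_Icc_right hb.2)))).aemeasurable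
        measurableSet_Ioo
    have hΦle : ENNReal.ofReal (∫ t in Ioo 0 b, Φ t) ≤ ∫⁻ t in Ioo 0 b, ENNReal.ofReal (Φ t) := by
      by_cases hf : Integrable Φ (volume.restrict (Ioo 0 b))
      · have hpos : Integrable (fun t => max (Φ t) 0) (volume.restrict (Ioo 0 b)) := hf.pos_part
        calc ENNReal.ofReal (∫ t in Ioo 0 b, Φ t) ≤ ENNReal.ofReal (∫ t in Ioo 0 b, max (Φ t) 0) :=
              ENNReal.ofReal_le_ofReal (integral_mono hf hpos fun t => le_max_left _ _)
          _ = ∫⁻ t in Ioo 0 b, ENNReal.ofReal (max (Φ t) 0) :=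
              ofReal_integral_eq_lintegral_ofReal hpos (Eventually.of_forall fun t => le_max_right _ _)
          _ = ∫⁻ t in Ioo 0 b, ENNReal.ofReal (Φ t) := by
              refine lintegral_congr fun t => ?_
              rcases le_total (Φ t) 0 with h | h
              · rw [max_eq_right h, ENNReal.ofReal_of_nonpos h, ENNReal.ofReal_zero]
              · rw [max_eq_left h]
      · rw [integral_undef hf, ENNReal.ofReal_zero]
        exact zero_le
    calc φ b = ENNReal.ofReal (Y 0 + ∫ t in Ioo 0 b, Φ t) := by
          show ENNReal.ofReal (Y b) = _
          rw [hYb]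
      _ ≤ ENNReal.ofReal (Y 0) + ENNReal.ofReal (∫ t in Ioo 0 b, Φ t) := ENNReal.ofReal_add_le
      _ ≤ ENNReal.ofReal (Y 0) + ∫⁻ t in Ioo 0 b, ENNReal.ofReal (Φ t) :=
          add_le_add le_rfl hΦle
      _ ≤ ENNReal.ofReal (Y 0) + ∫⁻ t in Ioo 0 b,
            (ENNReal.ofReal (ā t * Y t) + ENNReal.ofReal (C₄ * F t)) :=
          add_le_add le_rfl (setLIntegral_mono' measurableSet_Ioo hpt)
      _ = ENNReal.ofReal (Y 0) + ((∫⁻ t in Ioo 0 b, ENNReal.ofReal (ā t * Y t)) +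
            ∫⁻ t in Ioo 0 b, ENNReal.ofReal (C₄ * F t)) := by rw [lintegral_add_left' hmeas1]
      _ ≤ ENNReal.ofReal (Y 0) + ((∫⁻ t in Ioo 0 b, kern t * φ t) + ENNReal.ofReal (C₄ * I)) := by
          rw [hI1]
          exact add_le_add le_rfl (add_le_add le_rfl hI2)
      _ = Bg + ∫⁻ s in Ioo 0 b, kern s * φ s := by
          rw [hBg, ENNReal.ofReal_add (hY0 0) (by positivity)]
          ring
  -- hypotheses of Grönwall
  have hBgtop : Bg ≠ ⊤ := ENNReal.ofReal_ne_top
  have hφM : ∀ t ∈ Icc 0 T'', φ t ≤ V₀ := fun t ht => hYV t ht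
  have haconst : ∀ t ∈ Icc 0 T'', kern t ≤
      ENNReal.ofReal (a / (T - T'') + C₁ + C₂ * V₀.toReal + C₃ * Ē) := by
    intro t ht
    rw [hkdef]
    refine ENNReal.ofReal_le_ofReal ?_
    show a / (T - t) + C₁ + C₂ * Y t + C₃ * Ē ≤ a / (T - T'') + C₁ + C₂ * V₀.toReal + C₃ * Ē
    have hYV' : Y t ≤ V₀.toReal := by
      have h := hYV t ht
      exact (ENNReal.ofReal_le_iff_le_toReal hV₀top.ne).1 h
    have hdivle : a / (T - t) ≤ a / (T - T'') :=
      div_le_div_of_nonneg_left ha hTT (by linarith [ht.2])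
    nlinarith [mul_le_mul_of_nonneg_left hYV' hC₂, hdivle]
  have hatop : ∫⁻ t in Ioo 0 T'', kern t ≠ ⊤ := by
    refine ne_top_of_le_ne_top ?_ (setLIntegral_mono' measurableSet_Ioo fun t ht =>
      haconst t ⟨ht.1.le, ht.2.le⟩)
    rw [setLIntegral_const]
    exact ENNReal.mul_ne_top ENNReal.ofReal_ne_top (measure_Ioo_lt_top.ne)
  have hgron := lintegral_gronwall_le hBgtop hV₀top.ne hφM hatop hineq
  -- the exponent: `∫_{(0,t)} kern ≤ a log(T/(T − t)) + (C₁ + C₃Ē)T'' + C₂κ²I`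
  set E : ℝ := (C₁ + C₃ * Ē) * T'' + C₂ * (κ ^ 2 * I) with hEdef
  have hE0 : 0 ≤ E := by positivity
  have hlog0 : ∀ t ∈ Icc 0 T'', 0 ≤ a * Real.log (T / (T - t)) := fun t ht =>
    mul_nonneg ha (Real.log_nonneg ((one_le_div (hTt t ht)).2 (by linarith [ht.1])))
  have hexp : ∀ t ∈ Icc 0 T'', (∫⁻ s in Ioo 0 t, kern s).toReal ≤
      a * Real.log (T / (T - t)) + E := by
    intro t ht
    have hsplit : ∀ s ∈ Ioo 0 t, kern s ≤ ENNReal.ofReal (a / (T - s)) +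
        (ENNReal.ofReal (C₁ + C₃ * Ē) + ENNReal.ofReal (C₂ * κ ^ 2) * ENNReal.ofReal (F s)) := by
      intro s hs
      have hsS : s ∈ Icc 0 T'' := ⟨hs.1.le, hs.2.le.trans ht.2⟩
      have hκ0 : 0 ≤ C₂ * κ ^ 2 := mul_nonneg hC₂ (sq_nonneg _)
      have hc13 : 0 ≤ C₁ + C₃ * Ē := by positivity
      have hdiv0 : 0 ≤ a / (T - s) := div_nonneg ha (hTt s hsS).le
      rw [hkdef, ← ENNReal.ofReal_mul hκ0, ← ENNReal.ofReal_add hc13 (mul_nonneg hκ0 (hF0 s)),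
        ← ENNReal.ofReal_add hdiv0 (add_nonneg hc13 (mul_nonneg hκ0 (hF0 s)))]
      refine ENNReal.ofReal_le_ofReal ?_
      show a / (T - s) + C₁ + C₂ * Y s + C₃ * Ē ≤ a / (T - s) + (C₁ + C₃ * Ē + C₂ * κ ^ 2 * F s)
      nlinarith [hYle s hsS, hC₂]
    have hmeasdiv : Measurable fun s : ℝ => ENNReal.ofReal (a / (T - s)) :=
      (measurable_const.div (measurable_const.sub measurable_id)).ennreal_ofReal
    have h1 : ∫⁻ s in Ioo 0 t, kern s ≤ (∫⁻ s in Ioo 0 t, ENNReal.ofReal (a / (T - s))) +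
        ∫⁻ s in Ioo 0 T'', (ENNReal.ofReal (C₁ + C₃ * Ē) +
          ENNReal.ofReal (C₂ * κ ^ 2) * ENNReal.ofReal (F s)) := by
      calc ∫⁻ s in Ioo 0 t, kern s
          ≤ ∫⁻ s in Ioo 0 t, (ENNReal.ofReal (a / (T - s)) + (ENNReal.ofReal (C₁ + C₃ * Ē) +
              ENNReal.ofReal (C₂ * κ ^ 2) * ENNReal.ofReal (F s))) :=
            setLIntegral_mono' measurableSet_Ioo hsplit
        _ = (∫⁻ s in Ioo 0 t, ENNReal.ofReal (a / (T - s))) +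
              ∫⁻ s in Ioo 0 t, (ENNReal.ofReal (C₁ + C₃ * Ē) +
                ENNReal.ofReal (C₂ * κ ^ 2) * ENNReal.ofReal (F s)) :=
            lintegral_add_left hmeasdiv _
        _ ≤ _ := add_le_add le_rfl (lintegral_mono_set (Ioo_subset_Ioo le_rfl ht.2))
    have h2 : ∫⁻ s in Ioo 0 T'', (ENNReal.ofReal (C₁ + C₃ * Ē) +
          ENNReal.ofReal (C₂ * κ ^ 2) * ENNReal.ofReal (F s)) ≤
        ENNReal.ofReal (C₁ + C₃ * Ē) * volume (Ioo (0 : ℝ) T'') +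
          ENNReal.ofReal (C₂ * κ ^ 2) * ENNReal.ofReal I := by
      calc ∫⁻ s in Ioo 0 T'', (ENNReal.ofReal (C₁ + C₃ * Ē) +
            ENNReal.ofReal (C₂ * κ ^ 2) * ENNReal.ofReal (F s))
          = ENNReal.ofReal (C₁ + C₃ * Ē) * volume (Ioo (0 : ℝ) T'') +
            ENNReal.ofReal (C₂ * κ ^ 2) * ∫⁻ s in Ioo 0 T'', ENNReal.ofReal (F s) := by
            rw [lintegral_add_left measurable_const, setLIntegral_const,
              lintegral_const_mul' _ _ ENNReal.ofReal_ne_top]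
        _ ≤ _ := add_le_add le_rfl (mul_le_mul' le_rfl hIF)
    have h3 : (ENNReal.ofReal (C₁ + C₃ * Ē) * volume (Ioo (0 : ℝ) T'') +
        ENNReal.ofReal (C₂ * κ ^ 2) * ENNReal.ofReal I) = ENNReal.ofReal E := by
      rw [hEdef, Real.volume_Ioo, sub_zero, ← ENNReal.ofReal_mul (by positivity),
        ← ENNReal.ofReal_mul (by positivity), ← ENNReal.ofReal_add (by positivity) (by positivity)]
      ring_nf
    have h4 : ∫⁻ s in Ioo 0 t, ENNReal.ofReal (a / (T - s)) =
        ENNReal.ofReal (a * Real.log (T / (T - t))) :=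
      lintegral_Ioo_div_sub_eq ha ht.1 (ht.2.trans_lt hT''T)
    have h5 : ∫⁻ s in Ioo 0 t, kern s ≤ ENNReal.ofReal (a * Real.log (T / (T - t)) + E) := by
      refine h1.trans ?_
      rw [h4, ENNReal.ofReal_add (hlog0 t ht) hE0]
      exact add_le_add le_rfl (h2.trans_eq h3)
    have := ENNReal.toReal_mono ENNReal.ofReal_ne_top h5
    rwa [ENNReal.toReal_ofReal (add_nonneg (hlog0 t ht) hE0)] at this
  -- conclusion
  intro t ht
  have hg := hgron t ht
  have hbase : 0 < T / (T - t) := div_pos hT (hTt t ht)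
  have hrpow : 0 ≤ (T / (T - t)) ^ a := Real.rpow_nonneg hbase.le a
  have hexp_eq : Real.exp (a * Real.log (T / (T - t)) + E) = (T / (T - t)) ^ a * Real.exp E := by
    rw [Real.exp_add, Real.rpow_def_of_pos hbase, mul_comm (Real.log _) a]
  have hY00 : 0 ≤ (∫ x, ‖curl (u 0) x‖ ^ 2) + C₄ * I :=
    add_nonneg (integral_nonneg fun x => sq_nonneg _) (mul_nonneg hC₄ hI)
  have hfinal : φ t ≤ ENNReal.ofReal (((∫ x, ‖curl (u 0) x‖ ^ 2) + C₄ * I) *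
      ((T / (T - t)) ^ a * Real.exp E)) := by
    refine hg.trans ?_
    rw [hBg, ← ENNReal.ofReal_mul (by positivity)]
    refine ENNReal.ofReal_le_ofReal (mul_le_mul_of_nonneg_left ?_ hY00)
    rw [← hexp_eq]
    exact Real.exp_le_exp.2 (hexp t ht)
  have hnn : 0 ≤ ((∫ x, ‖curl (u 0) x‖ ^ 2) + C₄ * I) * ((T / (T - t)) ^ a * Real.exp E) :=
    mul_nonneg hY00 (mul_nonneg hrpow (Real.exp_pos _).le)
  have := (ENNReal.ofReal_le_ofReal_iff hnn).1 hfinal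
  rw [mul_assoc]
  exact this

end Summit.NavierStokesRegularity.NavierStokesRegularity.Theorems.CriticalCoherenceDoor

end
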